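import Mathlib
import HarnessLib

/-!
# Route `WeakCouplingBCS` — crux `WcbcsBcsConstruction` (stmt-HubbardSuperconductivity-2010),
# line `lro-seed-kink-bridge`, stub `stub_secantSlopes_of_concave_close`

A pure real-analysis lemma used to pin the chemical potential: if `f : ℝ → ℝ` is concave on
`ℝ`, uniformly `η`-close to a function `g` on the window `[x - r, x + r]`, and `g` has the
one-point Taylor estimate `|g y - g x - g' (y - x)| ≤ M (y - x)²` on that window, then every right
secant slope `(f (x + t) - f x) / t` of `f` at `x` with `0 < t ≤ r` is at least
`g' - M r - 2η / r`, and every left secant slope `(f x - f (x - t)) / t` is at most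
`g' + M r + 2η / r`.

Proof (folklore). Concavity gives the chord inequalities
`(r - t) f x + t f (x ± r) ≤ r f (x ± t)` (the point `x ± t` is the convex combination of `x`
and `x ± r` with weights `1 - t/r` and `t/r`), i.e. the right secant slope over `[x, x + t]`
dominates the one over `[x, x + r]` and the left secant slope over `[x - t, x]` is dominated by
the one over `[x - r, x]`. At `t = r` the two hypotheses (used at `y = x ± r` and `y = x`) give
`f (x + r) - f x ≥ g (x + r) - g x - 2η ≥ g' r - M r² - 2η` and
`f x - f (x - r) ≤ g x - g (x - r) + 2η ≤ g' r + M r² + 2η`; divide by `r > 0`.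
-/

set_option linter.dupNamespace false

namespace Summit.HubbardSuperconductivity.HubbardSuperconductivity.Theorems

/-- **Chord inequality for a concave function on `ℝ`**: if `z = (1 - t/r) x + (t/r) y` with
`0 ≤ t ≤ r`, `0 < r`, then `(r - t) f x + t f y ≤ r f z`. [folklore] -/
theorem concaveOn_univ_chord_le {f : ℝ → ℝ} (hf : ConcaveOn ℝ Set.univ f) {x y z t r : ℝ}
    (ht : 0 ≤ t) (hr : 0 < r) (htr : t ≤ r) (hz : (1 - t / r) * x + t / r * y = z) :
    (r - t) * f x + t * f y ≤ r * f z := by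
  have ha : 0 ≤ 1 - t / r := sub_nonneg.2 ((div_le_one hr).2 htr)
  have hb : 0 ≤ t / r := div_nonneg ht hr.le
  have key := hf.2 (Set.mem_univ x) (Set.mem_univ y) ha hb (sub_add_cancel 1 (t / r))
  simp only [smul_eq_mul] at key
  rw [hz] at key
  have key' := mul_le_mul_of_nonneg_left key hr.le
  calc (r - t) * f x + t * f y = r * ((1 - t / r) * f x + t / r * f y) := by
        field_simp
    _ ≤ r * f z := key'

/-- **Stub `stub_secantSlopes_of_concave_close`** of the line `lro-seed-kink-bridge` (crux
`WcbcsBcsConstruction`): a concave `f`, uniformly `η`-close on `[x - r, x + r]` to a function `g`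
obeying `|g y - g x - g' (y - x)| ≤ M (y - x)²` there, has all its right secant slopes at `x` of
step `t ∈ (0, r]` bounded below by `g' - M r - 2η/r` and all its left secant slopes bounded above
by `g' + M r + 2η/r`. [folklore] -/
theorem stub_secantSlopes_of_concave_close :
    ∀ (f g : ℝ → ℝ) (g' x r η M : ℝ), 0 < r →
      ConcaveOn ℝ Set.univ f →
      (∀ y ∈ Set.Icc (x - r) (x + r), |f y - g y| ≤ η) →
      (∀ y ∈ Set.Icc (x - r) (x + r), |g y - g x - g' * (y - x)| ≤ M * (y - x) ^ 2) →
      ∀ t ∈ Set.Ioc 0 r,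
        g' - M * r - 2 * η / r ≤ (f (x + t) - f x) / t ∧
          (f x - f (x - t)) / t ≤ g' + M * r + 2 * η / r := by
  intro f g g' x r η M hr hf hfg hg t ht
  obtain ⟨ht0, htr⟩ := ht
  -- closeness, as used: `g (x + r) - η ≤ f (x + r)`, `f x ≤ g x + η`, `g (x - r) - η ≤ f (x - r)`
  obtain ⟨hpr, -⟩ := abs_le.1 (hfg (x + r) ⟨by linarith, le_rfl⟩)
  obtain ⟨-, hx2⟩ := abs_le.1 (hfg x ⟨by linarith, by linarith⟩)
  obtain ⟨hmr, -⟩ := abs_le.1 (hfg (x - r) ⟨le_rfl, by linarith⟩)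
  -- the two Taylor facts, at `y = x + r` and `y = x - r`
  have hTr : g' * r - M * r ^ 2 ≤ g (x + r) - g x := by
    have h := (abs_le.1 (hg (x + r) ⟨by linarith, le_rfl⟩)).1
    have e : x + r - x = r := by ring
    rw [e] at h
    linarith
  have hTl : g x - g (x - r) ≤ g' * r + M * r ^ 2 := by
    have h := (abs_le.1 (hg (x - r) ⟨le_rfl, by linarith⟩)).1
    have e : x - r - x = -r := by ring
    rw [e, neg_sq, mul_neg] at h
    linarith
  -- the two chord inequalities from concavity
  have hR : (r - t) * f x + t * f (x + r) ≤ r * f (x + t) :=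
    concaveOn_univ_chord_le hf ht0.le hr htr (by field_simp; ring)
  have hL : (r - t) * f x + t * f (x - r) ≤ r * f (x - t) :=
    concaveOn_univ_chord_le hf ht0.le hr htr (by field_simp; ring)
  constructor
  · -- right secant slope
    have A : t * (g' * r - M * r ^ 2 - 2 * η) ≤ t * (f (x + r) - f x) :=
      mul_le_mul_of_nonneg_left (by linarith) ht0.le
    have e : g' - M * r - 2 * η / r = (g' * r - M * r ^ 2 - 2 * η) / r := by
      field_simp
    rw [e, div_le_div_iff₀ hr ht0]
    linarith
  · -- left secant slope
    have A : t * (f x - f (x - r)) ≤ t * (g' * r + M * r ^ 2 + 2 * η) :=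
      mul_le_mul_of_nonneg_left (by linarith) ht0.le
    have e : g' + M * r + 2 * η / r = (g' * r + M * r ^ 2 + 2 * η) / r := by
      field_simp
    rw [e, div_le_div_iff₀ ht0 hr]
    linarith

end Summit.HubbardSuperconductivity.HubbardSuperconductivity.Theorems
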